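import Summits.Ventures.HodgeRepro2.T5InertSatakeSets
import Summits.Ventures.HodgeRepro2.T5InertDegreeCount

/-!
# The unipotent coset counts of the Satake transform of `T₁` at an inert place
(cell pub-hodge-repro2, seat p3)

Tier-5 N3 support, towards T5-SATAKE-KERNEL-p3.md row 12. File 211 identified the sets
`S_m = {n ∈ N : a_m n ∈ K a₁ K}`; this file COUNTS the cosets `n N(R) ⊆ S_m` — the integral
`∫_N 1_{K a₁ K}(a_m n) dn` with `vol N(R) = 1`:

* `ncard_image_mk_coe` / `ncard_image_mk_diff` — for subgroups `N`, `H` of a group, the image of `H` in `G/N` has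
  `[H : N ∩ H]` elements, and the image of `H ∖ N` has `[H : N ∩ H] − 1` (a `Quotient.map'` bijection);
* `map_conj_map_conj_inv` — `g (g⁻¹ H g) g⁻¹ = H`;
* `relIndex_unipCong_one_two` — `[N(R) : N_{1,2}] = Q q²` (the tower `N_{0,0} ⊃ N_{1,0} ⊃ N_{1,1} ⊃ N_{1,2}`,
  file 196's indices);
* **`satakeCount j m`** — `#{n N(R) ⊆ N : a_m n ∈ K a_j K}`, and for `j = 1`:
  **`satakeCount_one_one`** `= Q q² = q⁴`, **`satakeCount_one_zero`** `= q − 1`, **`satakeCount_one_neg_one`** `= 1`,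
  **`satakeCount_one_of_two_le`** / **`satakeCount_one_of_le_neg_two`** `= 0`
  (`Q = #𝔽`, `q = #{t ∈ 𝔽 : t + t̄ = 0}`, `Q = q²` by file 202).

Mathlib + this seat's files 211 / 201 and their imports; no display; no device.
§8(d): uses an L-value-free non-vanishing device: NO.
-/

namespace Summit.Ventures.HodgeRepro2.T5InertSatakeCounts

open Summit.Ventures.HodgeRepro2.T5CartanCellsDistinct Summit.Ventures.HodgeRepro2.T5HeckeBasisCells
  Summit.Ventures.HodgeRepro2.T5HermitianThreeElements Summit.Ventures.HodgeRepro2.T5UnitaryGroupForm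
  Summit.Ventures.HodgeRepro2.T5UnitaryHeckeAdjoint Summit.Ventures.HodgeRepro2.T5InertUnipotentCongruence
  Summit.Ventures.HodgeRepro2.T5InertUnipotentResidue Summit.Ventures.HodgeRepro2.T5InertResidueInvolution
  Summit.Ventures.HodgeRepro2.T5InertDegreeCount Summit.Ventures.HodgeRepro2.T5InertUnipotentRadical
  Summit.Ventures.HodgeRepro2.T5InertSatakeSets

/-! ## Counting cosets: the image of a subgroup in a coset space -/

section Cosets

variable {G : Type*} [Group G]

/-- **The image of `H` in `G/N` has `[H : N ∩ H]` elements.** -/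
theorem ncard_image_mk_coe (N H : Subgroup G) :
    ((QuotientGroup.mk : G → G ⧸ N) '' (H : Set G)).ncard = N.relIndex H := by
  let f : H ⧸ N.subgroupOf H → G ⧸ N :=
    Quotient.map' (fun x : H => (x : G)) fun a b hab => by
      rw [QuotientGroup.leftRel_apply] at hab ⊢
      exact Subgroup.mem_subgroupOf.1 hab
  have hf : Function.Injective f := by
    intro a b hab
    obtain ⟨a, rfl⟩ := QuotientGroup.mk_surjective a
    obtain ⟨b, rfl⟩ := QuotientGroup.mk_surjective b
    change ((a : G) : G ⧸ N) = ((b : G) : G ⧸ N) at hab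
    rw [QuotientGroup.eq] at hab
    exact QuotientGroup.eq.2 (Subgroup.mem_subgroupOf.2 hab)
  have hrange : Set.range f = (QuotientGroup.mk : G → G ⧸ N) '' (H : Set G) := by
    ext c
    constructor
    · rintro ⟨a, rfl⟩
      obtain ⟨a, rfl⟩ := QuotientGroup.mk_surjective a
      exact ⟨a, a.2, rfl⟩
    · rintro ⟨g, hg, rfl⟩
      exact ⟨QuotientGroup.mk (⟨g, hg⟩ : H), rfl⟩
  rw [← hrange, Set.ncard_range_of_injective hf, Subgroup.relIndex, Subgroup.index_eq_card]

/-- The image of `H ∖ N` in `G/N` is the image of `H` without the trivial coset. -/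
theorem image_mk_diff (N H : Subgroup G) :
    (QuotientGroup.mk : G → G ⧸ N) '' ((H : Set G) \ (N : Set G)) =
      ((QuotientGroup.mk : G → G ⧸ N) '' (H : Set G)) \ {((1 : G) : G ⧸ N)} := by
  ext c
  constructor
  · rintro ⟨g, ⟨hgH, hgN⟩, rfl⟩
    refine ⟨⟨g, hgH, rfl⟩, fun hc => hgN ?_⟩
    rw [Set.mem_singleton_iff, QuotientGroup.eq, mul_one] at hc
    simpa using hc
  · rintro ⟨⟨g, hgH, rfl⟩, hc⟩
    refine ⟨g, ⟨hgH, fun hgN => hc ?_⟩, rfl⟩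
    rw [Set.mem_singleton_iff, QuotientGroup.eq, mul_one]
    exact Subgroup.inv_mem _ hgN

/-- **The image of `H ∖ N` in `G/N` has `[H : N ∩ H] − 1` elements.** -/
theorem ncard_image_mk_diff (N H : Subgroup G) :
    ((QuotientGroup.mk : G → G ⧸ N) '' ((H : Set G) \ (N : Set G))).ncard = N.relIndex H - 1 := by
  have h1 : ((1 : G) : G ⧸ N) ∈ (QuotientGroup.mk : G → G ⧸ N) '' (H : Set G) := ⟨1, Subgroup.one_mem _, rfl⟩
  rw [image_mk_diff, Set.ncard_sdiff_singleton_of_mem h1, ncard_image_mk_coe N H]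

/-- `g (g⁻¹ H g) g⁻¹ = H`. -/
theorem map_conj_map_conj_inv (g : G) (H : Subgroup G) :
    (H.map (MulAut.conj g⁻¹).toMonoidHom).map (MulAut.conj g).toMonoidHom = H := by
  ext x
  rw [Subgroup.mem_map_equiv, Subgroup.mem_map_equiv, MulAut.conj_symm_apply, MulAut.conj_symm_apply]
  have : g⁻¹⁻¹ * (g⁻¹ * x * g) * g⁻¹ = x := by group
  rw [this]

end Cosets

/-! ## The index `[N(R) : N_{1,2}]` -/

section Index

variable {R E : Type*} [CommRing R] [IsDomain R] [IsDiscreteValuationRing R] [Field E] [StarRing E]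
  [Algebra R E] [IsFractionRing R E]
  (hstar : ∀ x : E, IsLocalization.IsInteger R x → IsLocalization.IsInteger R (star x))
  (u : E) (hsu : star u = u) (hu0 : u ≠ 0) (hu' : IsLocalization.IsInteger R u⁻¹) {ϖ : R}
  (hϖ : Irreducible ϖ) (hs : star (algebraMap R E ϖ) = algebraMap R E ϖ)

include hsu hu0 hϖ in
/-- **`[N(R) : N_{1,2}] = Q q²`**: the tower `N_{0,0} ⊃ N_{1,0} ⊃ N_{1,1} ⊃ N_{1,2}`. -/
theorem relIndex_unipCong_one_two (htr : ∃ e : R, algebraMap R E e + star (algebraMap R E e) = 1) :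
    (unipCong hstar u hu' hs 1 2 le_rfl).relIndex (unipCong hstar u hu' hs 0 0 le_rfl) =
      Nat.card (IsLocalRing.ResidueField R) * Nat.card (traceZero R E) ^ 2 := by
  have h1 : unipCong hstar u hu' hs 1 (1 + 1) le_rfl ≤ unipCong hstar u hu' hs 1 1 one_le_two :=
    unipCong_mono hstar u hu' hs le_rfl (Nat.le_succ _)
  have h2 : unipCong hstar u hu' hs 1 (0 + 1) one_le_two ≤ unipCong hstar u hu' hs 1 0 (by norm_num) :=
    unipCong_mono hstar u hu' hs le_rfl (Nat.le_succ _)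
  have h3 : unipCong hstar u hu' hs (0 + 1) 0 (by norm_num) ≤ unipCong hstar u hu' hs 0 0 le_rfl :=
    unipCong_mono hstar u hu' hs (Nat.le_succ 0) le_rfl
  show (unipCong hstar u hu' hs 1 (1 + 1) _).relIndex (unipCong hstar u hu' hs 0 0 _) = _
  rw [← Subgroup.relIndex_mul_relIndex _ _ _ h1 (h2.trans h3), ← Subgroup.relIndex_mul_relIndex _ _ _ h2 h3,
    relIndex_unipCong_succ_right hstar u hsu hu0 hu' hϖ hs (a := 1) (b := 1) (hab := one_le_two) htr le_rfl,
    relIndex_unipCong_succ_right hstar u hsu hu0 hu' hϖ hs (a := 1) (b := 0) (hab := by norm_num) htr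
      one_le_two,
    relIndex_unipCong_succ_left hstar u hsu hu0 hu' hϖ hs (a := 0) (b := 0) (hab := le_rfl) htr (by norm_num)]
  ring

include hsu hu0 hϖ in
/-- `[N_{1,1} : N_{1,2}] = q`. -/
theorem relIndex_unipCong_one_two_one_one (htr : ∃ e : R, algebraMap R E e + star (algebraMap R E e) = 1) :
    (unipCong hstar u hu' hs 1 2 le_rfl).relIndex (unipCong hstar u hu' hs 1 1 one_le_two) =
      Nat.card (traceZero R E) :=
  relIndex_unipCong_succ_right hstar u hsu hu0 hu' hϖ hs (a := 1) (b := 1) (hab := one_le_two) htr le_rfl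

end Index

/-! ## The coset counts -/

section Counts

variable {R E : Type*} [CommRing R] [IsDomain R] [IsDiscreteValuationRing R] [Field E] [StarRing E]
  [Algebra R E] [IsFractionRing R E] [Finite (IsLocalRing.ResidueField R)]
  (hstar : ∀ x : E, IsLocalization.IsInteger R x → IsLocalization.IsInteger R (star x))
  (u : E) (hsu : star u = u) (hu0 : u ≠ 0) (hu : IsLocalization.IsInteger R u)
  (hu' : IsLocalization.IsInteger R u⁻¹) {ϖ : R} (hϖ : Irreducible ϖ)
  (hs : star (algebraMap R E ϖ) = algebraMap R E ϖ)

/-- **The number of cosets `n N(R) ⊆ N` with `a_m n ∈ K a_j K`** — the integral `∫_N 1_{K a_j K}(a_m n) dn`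
with `vol N(R) = 1`. -/
noncomputable def satakeCount (j : ℕ) (m : ℤ) : ℕ :=
  ((QuotientGroup.mk : formUnitaryGroup (J3 u) →
      formUnitaryGroup (J3 u) ⧸ unipCong hstar u hu' hs 0 0 le_rfl) '' satakeSet (R := R) u hϖ hs j m).ncard

omit [IsDomain R] [IsDiscreteValuationRing R] [Finite (IsLocalRing.ResidueField R)] in
/-- `a₁ N(R) a₁⁻¹ = N_{1,2}`. -/
theorem map_conj_cellZ_one_unipCong :
    (unipCong hstar u hu' hs 0 0 le_rfl).map (MulAut.conj (cellZ u hϖ hs 1)).toMonoidHom =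
      unipCong hstar u hu' hs 1 2 le_rfl := by
  have := map_conj_cellU_unipCong hstar u hu' hϖ hs 1 0 0 le_rfl (by norm_num)
  rw [← cellZ_natCast u hϖ hs 1] at this
  exact this

include hsu hu0 hu in
/-- **`satakeCount 1 1 = Q q²`.** -/
theorem satakeCount_one_one (htr : ∃ e : R, algebraMap R E e + star (algebraMap R E e) = 1) :
    satakeCount hstar u hu' hϖ hs 1 1 =
      Nat.card (IsLocalRing.ResidueField R) * Nat.card (traceZero R E) ^ 2 := by
  rw [satakeCount, satakeSet_one_one hstar u hsu hu0 hu hu' hϖ hs, ncard_image_mk_coe,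
    ← Subgroup.relIndex_map_map_of_injective (f := (MulAut.conj (cellZ u hϖ hs 1)).toMonoidHom) _ _
      (MulEquiv.injective _)]
  have h := map_conj_map_conj_inv (cellZ u hϖ hs 1) (unipCong hstar u hu' hs 0 0 le_rfl)
  rw [← cellZ_neg] at h
  rw [h, map_conj_cellZ_one_unipCong, relIndex_unipCong_one_two hstar u hsu hu0 hu' hϖ hs htr]

include hsu hu0 hu in
/-- **`satakeCount 1 0 = q − 1`.** -/
theorem satakeCount_one_zero (htr : ∃ e : R, algebraMap R E e + star (algebraMap R E e) = 1) :
    satakeCount hstar u hu' hϖ hs 1 0 = Nat.card (traceZero R E) - 1 := by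
  have hrel : (unipCong hstar u hu' hs 0 0 le_rfl).relIndex
      ((unipCong hstar u hu' hs 1 1 one_le_two).map (MulAut.conj (cellZ u hϖ hs (-1))).toMonoidHom) =
      Nat.card (traceZero R E) := by
    rw [← Subgroup.relIndex_map_map_of_injective (f := (MulAut.conj (cellZ u hϖ hs 1)).toMonoidHom) _ _
      (MulEquiv.injective _)]
    have h := map_conj_map_conj_inv (cellZ u hϖ hs 1) (unipCong hstar u hu' hs 1 1 one_le_two)
    rw [← cellZ_neg] at h
    rw [h, map_conj_cellZ_one_unipCong, relIndex_unipCong_one_two_one_one hstar u hsu hu0 hu' hϖ hs htr]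
  rw [satakeCount, satakeSet_one_zero hstar u hsu hu0 hu hu' hϖ hs, ncard_image_mk_diff, hrel]

include hsu hu0 hu in
/-- **`satakeCount 1 (−1) = 1`.** -/
theorem satakeCount_one_neg_one : satakeCount hstar u hu' hϖ hs 1 (-1) = 1 := by
  rw [satakeCount, satakeSet_one_neg_one hstar u hsu hu0 hu hu' hϖ hs, ncard_image_mk_coe,
    Subgroup.relIndex_self]

include hsu hu0 hu in
/-- **`satakeCount 1 m = 0` for `m ≥ 2`.** -/
theorem satakeCount_one_of_two_le {m : ℤ} (hm : 2 ≤ m) : satakeCount hstar u hu' hϖ hs 1 m = 0 := by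
  rw [satakeCount, satakeSet_one_of_two_le hstar u hsu hu0 hu hu' hϖ hs hm, Set.image_empty, Set.ncard_empty]

include hsu hu0 hu in
/-- **`satakeCount 1 m = 0` for `m ≤ −2`.** -/
theorem satakeCount_one_of_le_neg_two {m : ℤ} (hm : m ≤ -2) : satakeCount hstar u hu' hϖ hs 1 m = 0 := by
  rw [satakeCount, satakeSet_one_of_le_neg_two hstar u hsu hu0 hu hu' hϖ hs hm, Set.image_empty,
    Set.ncard_empty]

include hsu hu0 hu in
/-- **`satakeCount 1 1 = q⁴`** when the residue involution is non-trivial (`Q = q²`, file 202). -/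
theorem satakeCount_one_one_eq_pow_four (htr : ∃ e : R, algebraMap R E e + star (algebraMap R E e) = 1)
    (hnt : ∃ t : IsLocalRing.ResidueField R, residueStar hstar hϖ hs t ≠ t) :
    satakeCount hstar u hu' hϖ hs 1 1 = Nat.card (traceZero R E) ^ 4 := by
  rw [satakeCount_one_one hstar u hsu hu0 hu hu' hϖ hs htr, card_residueField_eq_sq hstar hϖ hs htr hnt]
  ring

end Counts

end Summit.Ventures.HodgeRepro2.T5InertSatakeCounts
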